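import Literature.InformationTheory.Entanglement.TwoRebitSeparabilityProbabilityBall
import HarnessLib

/-!
# The defect body in conformal coordinates: the similarity `V_ε⁻¹ (·) V_ε` is a Lorentz boost

Preparation for Lovas–Andai 2017, Lemma 6 (the defect function `χ₁`). In the conformal /
anticonformal coordinates `(p, q, r, s)` of a real `2 × 2` matrix
`K = [[p + r, −q + s], [q + s, p − r]]` (file `TwoRebitSeparabilityProbabilityBall`:
`K ∈ 𝔹 ↔ |(p, q)| + |(r, s)| ≤ 1`), the transposed similarity
`K ↦ (V_ε⁻¹ K V_ε)ᵀ`, `V_ε = diag(1, ε)`, which defines the defect body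
`rebitDefectBall ε = {K ∈ 𝔹 | (V_ε⁻¹ K V_ε)ᵀ ∈ 𝔹}`, fixes `p` and `r` and acts on `(q, s)` by the
hyperbolic rotation ("boost") `(q, s) ↦ (−(ch·q − sh·s), ch·s − sh·q)` with
`ch = (ε + ε⁻¹)/2`, `sh = (ε − ε⁻¹)/2` (`ch² − sh² = 1`; for `ε = e^δ`, `ch = cosh δ`,
`sh = sinh δ`). Hence (`volume_rebitDefectBall_eq_four_mul`)

  `χ₁(ε) = λ₄(rebitDefectBall ε) = 4 · λ₄{y | |(p,q)| + |(r,s)| ≤ 1 ∧ |(p, ch q − sh s)| + |(r, ch s − sh q)| ≤ 1}`.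

This is the structure behind Lovas–Andai's atlas `X_±(r, t, ρ, φ)` of Appendix A, in which "the
similarity transformation by `Λ_δ` is just a translation `t ↦ t − δ`": in hyperbolic polar
coordinates `(q, s) = (σ sinh τ, σ cosh τ)` the boost is the translation `τ ↦ τ − δ`
(`rebitBoost_hyperbolic`).

## References

* [LovasAndai2017] A. Lovas, A. Andai, Invariance of separability probability over reduced states
  in 4 × 4 bipartite systems, J. Phys. A 50 (2017) 295303, Definition 1 and Appendix A
  (proof of Lemma 6: the atlas (parR) and the translation property).
-/

noncomputable section

open MeasureTheory Set Real
open scoped ENNReal Matrix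

namespace Literature.InformationTheory.Entanglement

/-! ### The boosted defect body in conformal coordinates -/

/-- The hyperbolic cosine parameter `ch = (ε + ε⁻¹)/2` of the boost. [folklore] -/
def rebitCh (ε : ℝ) : ℝ := (ε + ε⁻¹) / 2

/-- The hyperbolic sine parameter `sh = (ε − ε⁻¹)/2` of the boost. [folklore] -/
def rebitSh (ε : ℝ) : ℝ := (ε - ε⁻¹) / 2

/-- `ch² − sh² = 1` (`ε ≠ 0`). [folklore] -/
theorem rebitCh_sq_sub_rebitSh_sq {ε : ℝ} (hε : ε ≠ 0) : rebitCh ε ^ 2 - rebitSh ε ^ 2 = 1 := by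
  unfold rebitCh rebitSh
  field_simp
  ring

/-- For `ε = e^δ`: `ch = cosh δ`. [folklore] -/
theorem rebitCh_exp (δ : ℝ) : rebitCh (exp δ) = cosh δ := by
  rw [rebitCh, cosh_eq, exp_neg]

/-- For `ε = e^δ`: `sh = sinh δ`. [folklore] -/
theorem rebitSh_exp (δ : ℝ) : rebitSh (exp δ) = sinh δ := by
  rw [rebitSh, sinh_eq, exp_neg]

/-- **The defect body in conformal coordinates**: `y = (p, q, r, s)` with
`|(p, q)| + |(r, s)| ≤ 1` and `|(p, ch q − sh s)| + |(r, ch s − sh q)| ≤ 1`.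
[cite: LovasAndai2017, Definition 1 and Appendix A] -/
def rebitConfDefectBody (ε : ℝ) : Set (Fin 4 → ℝ) :=
  {y | y ∈ rebitConfBody ∧
    Real.sqrt (y 0 ^ 2 + (rebitCh ε * y 1 - rebitSh ε * y 3) ^ 2) +
      Real.sqrt (y 2 ^ 2 + (rebitCh ε * y 3 - rebitSh ε * y 1) ^ 2) ≤ 1}

/-- `rebitConfDefectBody ε ⊆ rebitConfBody`. [folklore] -/
theorem rebitConfDefectBody_subset (ε : ℝ) : rebitConfDefectBody ε ⊆ rebitConfBody :=
  fun _ h => h.1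

/-- `rebitConfDefectBody ε` is closed. [folklore] -/
theorem isClosed_rebitConfDefectBody (ε : ℝ) : IsClosed (rebitConfDefectBody ε) := by
  have h : IsClosed {y : Fin 4 → ℝ |
      Real.sqrt (y 0 ^ 2 + (rebitCh ε * y 1 - rebitSh ε * y 3) ^ 2) +
        Real.sqrt (y 2 ^ 2 + (rebitCh ε * y 3 - rebitSh ε * y 1) ^ 2) ≤ 1} :=
    isClosed_le (by fun_prop) continuous_const
  exact isClosed_rebitConfBody.inter h

/-- `rebitConfDefectBody ε` is measurable. [folklore] -/
theorem measurableSet_rebitConfDefectBody (ε : ℝ) : MeasurableSet (rebitConfDefectBody ε) :=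
  (isClosed_rebitConfDefectBody ε).measurableSet

/-- The conformal coordinates of the transposed similar matrix `(V_ε⁻¹ K V_ε)ᵀ`:
`p' = p`, `q' = −(ch q − sh s)`, `r' = r`, `s' = ch s − sh q`. [cite: LovasAndai2017, Appendix A (the translation property of the atlas)] -/
theorem rebitConfMatrix_mulVec_defect {ε : ℝ} (hε : ε ≠ 0) (k : Fin 4 → ℝ) :
    rebitConfMatrix *ᵥ ![k 0, k 2 / ε, ε * k 1, k 3] =
      ![(k 0 + k 3) / 2,
        -(rebitCh ε * ((k 2 - k 1) / 2) - rebitSh ε * ((k 1 + k 2) / 2)),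
        (k 0 - k 3) / 2,
        rebitCh ε * ((k 1 + k 2) / 2) - rebitSh ε * ((k 2 - k 1) / 2)] := by
  rw [rebitConfMatrix_mulVec]
  unfold rebitCh rebitSh
  ext i
  fin_cases i <;> simp <;> field_simp <;> ring

/-- **The defect body is the preimage of the boosted body under the conformal coordinate map**
(`ε ≠ 0`). [cite: LovasAndai2017, Definition 1 and Appendix A] -/
theorem mem_rebitDefectBall_iff_conf {ε : ℝ} (hε : ε ≠ 0) (k : Fin 4 → ℝ) :
    k ∈ rebitDefectBall ε ↔ rebitConfMatrix *ᵥ k ∈ rebitConfDefectBody ε := by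
  rw [rebitDefectBall, mem_setOf_eq, mem_rebitOpBall_iff_conf, mem_rebitOpBall_iff_conf,
    rebitConfMatrix_mulVec_defect hε, rebitConfDefectBody, mem_setOf_eq, rebitConfMatrix_mulVec]
  simp only [rebitConfBody, mem_setOf_eq, Matrix.cons_val_zero, Matrix.cons_val_one,
    Matrix.cons_val, neg_sq]

/-- `rebitDefectBall ε = Ψ⁻¹(rebitConfDefectBody ε)` for the conformal coordinate map `Ψ`
(`ε ≠ 0`). [cite: LovasAndai2017, Definition 1 and Appendix A] -/
theorem rebitDefectBall_eq_preimage {ε : ℝ} (hε : ε ≠ 0) :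
    rebitDefectBall ε = Matrix.toLin' rebitConfMatrix ⁻¹' rebitConfDefectBody ε := by
  ext k
  rw [mem_preimage, Matrix.toLin'_apply]
  exact mem_rebitDefectBall_iff_conf hε k

/-- **`χ₁(ε) = 4 · λ₄(rebitConfDefectBody ε)`** (Jacobian of the conformal coordinates; `ε ≠ 0`).
[cite: LovasAndai2017, Definition 1 and Appendix A] -/
theorem volume_rebitDefectBall_eq_four_mul {ε : ℝ} (hε : ε ≠ 0) :
    volume (rebitDefectBall ε) = 4 * volume (rebitConfDefectBody ε) := by
  have hdet : LinearMap.det (Matrix.toLin' rebitConfMatrix) ≠ 0 := by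
    rw [LinearMap.det_toLin']
    intro h
    have h1 := abs_det_rebitConfMatrix
    rw [h, abs_zero] at h1
    norm_num at h1
  rw [rebitDefectBall_eq_preimage hε, Measure.addHaar_preimage_linearMap volume hdet,
    LinearMap.det_toLin', abs_inv, abs_det_rebitConfMatrix]
  norm_num

/-! ### In hyperbolic polar coordinates the boost is a translation -/

/-- On the branch `(q, s) = (σ sinh τ, σ cosh τ)`: `ch q − sh s = σ sinh(τ − δ)` and
`ch s − sh q = σ cosh(τ − δ)` for `ε = e^δ` — Lovas–Andai: "the similarity transformation by
`Λ_δ` is just a translation `(r, t, ρ, φ) ⟹ (r, t − δ, ρ, φ)`". [cite: LovasAndai2017, Appendix A] -/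
theorem rebitBoost_hyperbolic (δ σ τ : ℝ) :
    rebitCh (exp δ) * (σ * sinh τ) - rebitSh (exp δ) * (σ * cosh τ) = σ * sinh (τ - δ) ∧
      rebitCh (exp δ) * (σ * cosh τ) - rebitSh (exp δ) * (σ * sinh τ) = σ * cosh (τ - δ) := by
  rw [rebitCh_exp, rebitSh_exp, sinh_sub, cosh_sub]
  constructor <;> ring

/-- On the conjugate branch `(q, s) = (σ cosh τ, σ sinh τ)` the boost is the same translation with
the roles of `cosh`, `sinh` exchanged. [cite: LovasAndai2017, Appendix A] -/
theorem rebitBoost_hyperbolic' (δ σ τ : ℝ) :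
    rebitCh (exp δ) * (σ * cosh τ) - rebitSh (exp δ) * (σ * sinh τ) = σ * cosh (τ - δ) ∧
      rebitCh (exp δ) * (σ * sinh τ) - rebitSh (exp δ) * (σ * cosh τ) = σ * sinh (τ - δ) :=
  ⟨(rebitBoost_hyperbolic δ σ τ).2, (rebitBoost_hyperbolic δ σ τ).1⟩

/-- **The membership condition on the branch `(q, s) = (σ sinh τ, σ cosh τ)`** (`ε = e^δ`):
`(p, σ sinh τ, r, σ cosh τ) ∈ rebitConfDefectBody ↔ g(τ) ≤ 1 ∧ g(τ − δ) ≤ 1` with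
`g(τ) = √(p² + σ² sinh² τ) + √(r² + σ² cosh² τ)`. [cite: LovasAndai2017, Appendix A (proof of Lemma 6)] -/
theorem mem_rebitConfDefectBody_hyperbolic (δ p r σ τ : ℝ) :
    (![p, σ * sinh τ, r, σ * cosh τ] : Fin 4 → ℝ) ∈ rebitConfDefectBody (exp δ) ↔
      Real.sqrt (p ^ 2 + (σ * sinh τ) ^ 2) + Real.sqrt (r ^ 2 + (σ * cosh τ) ^ 2) ≤ 1 ∧
        Real.sqrt (p ^ 2 + (σ * sinh (τ - δ)) ^ 2) +
          Real.sqrt (r ^ 2 + (σ * cosh (τ - δ)) ^ 2) ≤ 1 := by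
  obtain ⟨h1, h2⟩ := rebitBoost_hyperbolic δ σ τ
  simp only [rebitConfDefectBody, rebitConfBody, mem_setOf_eq, Matrix.cons_val_zero,
    Matrix.cons_val_one, Matrix.cons_val, h1, h2]

/-- The same on the branch `(q, s) = (σ cosh τ, σ sinh τ)` (roles of `p`, `r` exchanged in `g`).
[cite: LovasAndai2017, Appendix A (proof of Lemma 6)] -/
theorem mem_rebitConfDefectBody_hyperbolic' (δ p r σ τ : ℝ) :
    (![p, σ * cosh τ, r, σ * sinh τ] : Fin 4 → ℝ) ∈ rebitConfDefectBody (exp δ) ↔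
      Real.sqrt (p ^ 2 + (σ * cosh τ) ^ 2) + Real.sqrt (r ^ 2 + (σ * sinh τ) ^ 2) ≤ 1 ∧
        Real.sqrt (p ^ 2 + (σ * cosh (τ - δ)) ^ 2) +
          Real.sqrt (r ^ 2 + (σ * sinh (τ - δ)) ^ 2) ≤ 1 := by
  obtain ⟨h1, h2⟩ := rebitBoost_hyperbolic' δ σ τ
  simp only [rebitConfDefectBody, rebitConfBody, mem_setOf_eq, Matrix.cons_val_zero,
    Matrix.cons_val_one, Matrix.cons_val, h1, h2]

end Literature.InformationTheory.Entanglement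

end
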